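import Literature.MathematicalPhysics.QuantumFieldTheory.WilsonFinTorusSliceObservables
import Literature.MathematicalPhysics.QuantumFieldTheory.WilsonFinTorusTwistedPartitionSwap
import Literature.Barriers.QuantumFields.FiniteTemperatureDeconfinementInfrared
import HarnessLib

/-!
# Dictionary: observables of the `Fin`-box `L³ × T` ↔ Borgs–Seiler's finite-temperature ensemble, and Polyakov
# lines ↔ slice Polyakov holonomies of the second transfer-matrix reading

Part 6 of the transfer-matrix formalism for Wilson's lattice gauge theory on the anisotropic `Fin`-box (parts 1–5:
`WilsonFinTorusSliceKernel.lean`, `WilsonFinTorusSliceChain.lean`, `WilsonFinTorusSpectralData.lean`,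
`WilsonFinTorusTwistedPartition.lean` (+ `…Swap.lean`), `WilsonFinTorusSliceObservables.lean`).

`WilsonFinTorusPartition.lean` identifies the PARTITION FUNCTION of the box `L × L × L × T` (time = the last axis)
with the one of the finite-temperature ensemble `FiniteTemperature` of `Literature/Barriers/QuantumFields/`
(Borgs–Seiler 1983: sites `ℤ_T × (ℤ/L)³`, time FIRST, couplings `J_E = J_M = β`) up to the constant `e^{−T c_{β,L}}`
(`wilsonFinTorusPartition_eq_exp_mul_integral_weight`, along the link bijection `finTorusConfigEquiv`).  This file
lifts the identification to OBSERVABLES and to the Polyakov loop, and composes it with the `0 ↔ 3` axis exchange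
(`WilsonFinTorusTwistedPartitionSwap.lean`) under which Polyakov lines become slice observables:

* `finTorusTimeLine V y = V((y,0),3) V((y,1),3) ⋯ V((y,T−1),3)` — the Polyakov line of the `Fin`-box along its time
  axis `3` at the spatial position `y ∈ Fin L × Fin L × Fin L`; under the `0 ↔ 3` relabelling it is the slice Polyakov
  holonomy `finSlicePolyakovHolonomy (finTorusSlice V' y₀) (y₁, y₂)` of part 5 (`finTorusTimeLine_swap03`);
* `timeHolonomy_eq_prod_ofFn`, `polyakovLine_eq_prod_ofFn` — Borgs–Seiler's recursive time holonomy as an ordered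
  product; `finTorusTimeLine_finTorusConfigEquiv` / `polyakovLine_eq_finTorusTimeLine` — **the Polyakov line of the
  finite-temperature configuration `U` at `x ∈ (ℤ/L)³` is the time line of the reindexed configuration** at the
  `Fin`-coordinates of `x`;
* `integral_mul_finTorusTwistedWeight_one_eq_exp_mul` and **`finTorusExpectation_eq_expectation`**:
  `⟨Φ⟩^{Fin-box}_{ρ,β}(L,L,L,T) = ⟨Φ ∘ finTorusConfigEquiv⟩^{FT}_{ρ,β,β}` for EVERY observable `Φ` (unitary `ρ`; the
  constant `e^{−T c}` cancels in the ratio), and conversely `expectation_eq_finTorusExpectation`;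
* **`polyakovCorrelation_eq_finTorusExpectation`**: Borgs–Seiler's two-point function
  `G_L(x) = Re ⟨χ(g_{L_0}) χ̄(g_{L_x})⟩` ((II.22)) is the `Fin`-box expectation of `Re(tr ρ(P₀) conj tr ρ(P_y))` with
  time lines `P`; and, composed with the observable-level axis exchange
  (`integral_mul_finTorusTwistedWeight_relabel`, `finTorusExpectation_swap03`),
  **`polyakovCorrelation_eq_finTorusExpectation_swap03`**: `G_L(x)` is the expectation, in the box `T × L × L × L`
  sliced along ITS last axis (the old axis `0`, period `L`), of the product of the traced slice Polyakov holonomies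
  at slice `0`, transverse position `(0,0)` and at slice `y₀`, transverse position `(y₁, y₂)` — two multiplication
  operators `L/2`-type slices apart, i.e. exactly the input shape of the two-insertion slicing theorem
  `integral_sliceObs_two_mul_finTorusWeight` of part 5 (`Z·⟨F₁(𝒰₀)F₂(𝒰_p)⟩ = Tr(𝕋^{m+1−p} F̂₁ 𝕋^p F̂₂)` in path space)
  — Borgs–Seiler's "transfer matrix in the spatial 1-direction" reading of the Polyakov correlation (§III.2, p. 349).

* `expectation_re_polyakovTrace_mul_conj` (general pairs: `⟨Re χ(g_{L_x}) χ̄(g_{L_y})⟩ = G_L(y − x)` by translation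
  invariance, `FiniteTemperature.polyakovKernel_add`) and **`finTorusExpectation_slicePolyakov_pair_swap03`**: the
  expectation in the box `T × L × L × L` of `Re(tr ρ(P_q(𝒰_s)) conj tr ρ(P_{q'}(𝒰_{s'})))` for ANY two slice∕transverse
  positions is `G_L((s',q') − (s,q))` — the summand of the slice-magnetisation correlations `⟨m(𝒰_s) m(𝒰_{s'})⟩`.

Everything is PROVED (changes of variables and reindexing; no estimate).  HONEST FRAMING: nothing here is an infrared
bound, long-range order, deconfinement, a statement about twisted partition functions' size, a lattice mass gap or the
Yang–Mills mass gap (Clay); it is the bookkeeping that lets the finite-volume Borgs–Seiler theorems of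
`FiniteTemperature*` be read in the transfer-matrix picture of the `Fin`-box.

References: C. Borgs, E. Seiler, Commun. Math. Phys. 91 (1983) 329, §II.3 (II.20)–(II.22), Lemma II.4, §III.2
(p. 349); I. Montvay, G. Münster, *Quantum Fields on a Lattice* (1994) §1.5.2 (1.195), §3.2.6 (3.139)–(3.145), §4.2;
G. 't Hooft, Nucl. Phys. B 153 (1979) 141, §6 (6.1)–(6.2).
-/

noncomputable section

open scoped BigOperators ComplexConjugate
open MeasureTheory Filter Function
open Literature.Barriers.QuantumFields

namespace Literature.MathematicalPhysics.QuantumFieldTheory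

/-! ### The Polyakov line of the `Fin`-box along its time axis -/

section TimeLine

variable {n₀ n₁ n₂ n₃ : ℕ} {G : Type*} [Group G]

/-- **The Polyakov line of the `Fin`-box along its time axis `3`** at the spatial position `y = (y₀, y₁, y₂)`: the
ordered product `V((y,0),3) V((y,1),3) ⋯ V((y,n₃−1),3)` of the `n₃` time-like links above `y` (closed by periodicity,
starting at time `0`) — Borgs–Seiler's `g_{L_x}` for the box with time = the last axis.
[cite: BorgsSeiler1983, §II.3 Lemma II.4 and Remark 1 (p. 336)] -/
def finTorusTimeLine (V : FinTorusSite n₀ n₁ n₂ n₃ × Fin 4 → G) (y : FinSpatialSite n₀ n₁ n₂) : G :=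
  (List.ofFn fun k : Fin n₃ => V ((y.1, y.2.1, y.2.2, k), 3)).prod

/-- Unfolding of `finTorusTimeLine`. [cite: BorgsSeiler1983, §II.3 Lemma II.4 (p. 336)] -/
theorem finTorusTimeLine_eq (V : FinTorusSite n₀ n₁ n₂ n₃ × Fin 4 → G) (y : FinSpatialSite n₀ n₁ n₂) :
    finTorusTimeLine V y = (List.ofFn fun k : Fin n₃ => V ((y.1, y.2.1, y.2.2, k), 3)).prod :=
  rfl

/-- **Under the `0 ↔ 3` axis exchange the time line becomes a slice Polyakov holonomy**: for a configuration `V'` of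
the exchanged box `n₃ × n₁ × n₂ × n₀`, the time line at `y = (y₀, y₁, y₂)` of the pulled-back configuration
`V = V' ∘ swap₀₃`, `V((x₀,x₁,x₂,x₃), μ) = V'((x₃,x₁,x₂,x₀), (0 3)·μ)`, is the holonomy along the FIRST axis, at transverse
position `(y₁, y₂)`, of the slice `y₀` of `V'` (sliced along ITS last axis = the old axis `0`): Polyakov loops are
multiplication operators of the second transfer-matrix reading. [cite: tHooft1979Flux, §6 (6.1)–(6.2)] [cite: BorgsSeiler1983, §III.2 (p. 349)] -/
theorem finTorusTimeLine_swap03 (V' : FinTorusSite n₃ n₁ n₂ n₀ × Fin 4 → G) (y : FinSpatialSite n₀ n₁ n₂) :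
    finTorusTimeLine (fun l : FinTorusSite n₀ n₁ n₂ n₃ × Fin 4 =>
        V' ((l.1.2.2.2, l.1.2.1, l.1.2.2.1, l.1.1), Equiv.swap (0 : Fin 4) 3 l.2)) y =
      finSlicePolyakovHolonomy (finTorusSlice V' y.1) (y.2.1, y.2.2) := by
  rw [finSlicePolyakovHolonomy_finTorusSlice, finTorusTimeLine_eq]
  simp only [Equiv.swap_apply_right]

/-- **Conversely** (the exchange is an involution): the slice Polyakov holonomy, at slice `y₀` and transverse position
`(y₁, y₂)`, of the pulled-back configuration `V' ∘ swap₀₃` of the exchanged box is the time line of `V'` at `y`.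
[cite: tHooft1979Flux, §6 (6.1)–(6.2)] [cite: BorgsSeiler1983, §III.2 (p. 349)] -/
theorem finSlicePolyakovHolonomy_finTorusSlice_swap03 (V' : FinTorusSite n₀ n₁ n₂ n₃ × Fin 4 → G)
    (y : FinSpatialSite n₀ n₁ n₂) :
    finSlicePolyakovHolonomy (finTorusSlice (fun l : FinTorusSite n₃ n₁ n₂ n₀ × Fin 4 =>
        V' ((l.1.2.2.2, l.1.2.1, l.1.2.2.1, l.1.1), Equiv.swap (0 : Fin 4) 3 l.2)) y.1) (y.2.1, y.2.2) =
      finTorusTimeLine V' y := by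
  rw [finSlicePolyakovHolonomy_finTorusSlice, finTorusTimeLine_eq]
  simp only [Equiv.swap_apply_left]

/-- Continuity of an ordered product of finitely many continuous factors. [cite: MontvayMunster1994, §3.2.2 (3.65)] -/
private theorem continuous_prod_ofFn' [TopologicalSpace G] [ContinuousMul G] {X : Type*} [TopologicalSpace X] :
    ∀ {k : ℕ} (f : Fin k → X → G), (∀ i, Continuous (f i)) → Continuous fun x => (List.ofFn fun i => f i x).prod
  | 0, f, _ => by simpa [List.ofFn_zero] using continuous_const
  | k + 1, f, hf => by
    simp_rw [List.ofFn_succ, List.prod_cons]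
    exact (hf 0).mul (continuous_prod_ofFn' (fun i => f i.succ) fun i => hf i.succ)

/-- The time line is continuous in the configuration. [cite: BorgsSeiler1983, §II.3 Lemma II.4 (p. 336)] -/
@[fun_prop] theorem continuous_finTorusTimeLine [TopologicalSpace G] [IsTopologicalGroup G] (y : FinSpatialSite n₀ n₁ n₂) :
    Continuous fun V : FinTorusSite n₀ n₁ n₂ n₃ × Fin 4 → G => finTorusTimeLine V y :=
  continuous_prod_ofFn' (fun (k : Fin n₃) (V : FinTorusSite n₀ n₁ n₂ n₃ × Fin 4 → G) => V ((y.1, y.2.1, y.2.2, k), 3))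
    fun _ => continuous_apply _

end TimeLine

/-! ### Borgs–Seiler's time holonomy as an ordered product; the Polyakov line under the reindexing -/

section Holonomy

variable {G : Type*} [Group G]

/-- The ring isomorphism `Fin T ≃+* ZMod T` is the cast of the underlying natural number. [folklore] -/
private theorem finEquiv_apply_eq_natCast (T : ℕ) [NeZero T] (k : Fin T) :
    ZMod.finEquiv T k = ((k : ℕ) : ZMod T) := by
  obtain ⟨T', rfl⟩ := Nat.exists_eq_succ_of_ne_zero (NeZero.ne T)
  exact (Fin.cast_val_eq_self k).symm

/-- **Borgs–Seiler's time holonomy is the ordered product of the time-like links**: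
`timeHolonomy U m (t, x) = U((t,x),0) U((t+1,x),0) ⋯ U((t+m−1,x),0)`. [cite: BorgsSeiler1983, §II.3 Lemma II.4 (p. 336)] -/
theorem timeHolonomy_eq_prod_ofFn {d L₀ L : ℕ} (U : FiniteTemperature.Config d L₀ L G) (m : ℕ) (t : ZMod L₀)
    (x : Fin d → ZMod L) :
    FiniteTemperature.timeHolonomy U m (t, x) = (List.ofFn fun k : Fin m => U ((t + (k : ℕ), x), none)).prod := by
  induction m generalizing t with
  | zero => simp [FiniteTemperature.timeHolonomy]
  | succ m ih =>
    rw [List.ofFn_succ, List.prod_cons]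
    calc FiniteTemperature.timeHolonomy U (m + 1) (t, x)
        = U ((t, x), none) * FiniteTemperature.timeHolonomy U m (t + 1, x) := rfl
      _ = U ((t, x), none) * (List.ofFn fun k : Fin m => U ((t + 1 + (k : ℕ), x), none)).prod := by rw [ih]
      _ = U ((t + ((0 : Fin (m + 1)) : ℕ), x), none) *
            (List.ofFn fun i : Fin m => U ((t + ((i.succ : Fin (m + 1)) : ℕ), x), none)).prod := by
          simp only [Fin.val_zero, Nat.cast_zero, add_zero, Fin.val_succ, Nat.cast_succ, add_assoc, add_comm (1 : ZMod L₀)]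

/-- **The Polyakov line as an ordered product**: `g_{L_x} = U((0,x),0) U((1,x),0) ⋯ U((L₀−1,x),0)`.
[cite: BorgsSeiler1983, §II.3 Lemma II.4 and Remark 1 (p. 336)] -/
theorem polyakovLine_eq_prod_ofFn {d L₀ L : ℕ} (U : FiniteTemperature.Config d L₀ L G) (x : Fin d → ZMod L) :
    FiniteTemperature.polyakovLine U x = (List.ofFn fun k : Fin L₀ => U ((((k : ℕ) : ZMod L₀), x), none)).prod := by
  rw [FiniteTemperature.polyakovLine, timeHolonomy_eq_prod_ofFn]
  simp only [zero_add]

variable [MeasurableSpace G] {L T : ℕ} [NeZero L] [NeZero T]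

/-- **The time line of the reindexed configuration is the Polyakov line** at the corresponding spatial site:
`finTorusTimeLine (finTorusConfigEquiv U) (y₀,y₁,y₂) = g_{L_x}(U)`, `x = (y₀, y₁, y₂) mod L`.
[cite: BorgsSeiler1983, §II.3 Lemma II.4 (p. 336)] [cite: MontvayMunster1994, §3.2.6 (3.139)] -/
theorem finTorusTimeLine_finTorusConfigEquiv (U : FiniteTemperature.Config 3 T L G) (y : FinSpatialSite L L L) :
    finTorusTimeLine (finTorusConfigEquiv G L T U) y =
      FiniteTemperature.polyakovLine U ![ZMod.finEquiv L y.1, ZMod.finEquiv L y.2.1, ZMod.finEquiv L y.2.2] := by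
  rw [finTorusTimeLine_eq, polyakovLine_eq_prod_ofFn, coe_finTorusConfigEquiv]
  refine congrArg List.prod (List.ofFn_inj.mpr (funext fun k => ?_))
  simp only [finTorusSiteEquiv, Equiv.coe_fn_mk, finTorusDirEquiv_three, finEquiv_apply_eq_natCast T k]

/-- **The Polyakov line at `x ∈ (ℤ/L)³` is the time line of the reindexed configuration at the `Fin`-coordinates of
`x`.** [cite: BorgsSeiler1983, §II.3 Lemma II.4 (p. 336)] [cite: MontvayMunster1994, §3.2.6 (3.139)] -/
theorem polyakovLine_eq_finTorusTimeLine (U : FiniteTemperature.Config 3 T L G) (x : Fin 3 → ZMod L) :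
    FiniteTemperature.polyakovLine U x =
      finTorusTimeLine (finTorusConfigEquiv G L T U)
        ((ZMod.finEquiv L).symm (x 0), (ZMod.finEquiv L).symm (x 1), (ZMod.finEquiv L).symm (x 2)) := by
  rw [finTorusTimeLine_finTorusConfigEquiv]
  congr 1
  ext j
  fin_cases j <;> simp

end Holonomy

/-! ### Expectations: the `Fin`-box `L³ × T` is the finite-temperature ensemble (`d = 3`, `L₀ = T`, `J_E = J_M = β`) -/

section Expectation

variable {G : Type*} [Group G] {n : ℕ} (ρ : G →* Matrix (Fin n) (Fin n) ℂ) [TopologicalSpace G]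
  [IsTopologicalGroup G] [CompactSpace G] [MeasurableSpace G] [BorelSpace G] {L T : ℕ} [NeZero L] [NeZero T]

/-- **Observable-level reindexing** (unitary `ρ`): for every `Φ`,
`∫ Φ(V) e^{−βS(V)} ∏ dV = e^{−T c_{β,L}} ∫ Φ(finTorusConfigEquiv U) e^{−S_W(J_E=J_M=β)}(U) ∏ dU` — the link
bijection preserves the product Haar measure and the Wilson exponent of the reindexed configuration is the
finite-temperature action plus a constant (`neg_mul_sum_finTorusPlaquette_comp`).
[cite: MontvayMunster1994, §3.2.6 (3.139)–(3.145)] [cite: BorgsSeiler1983, §II.3 (II.20)–(II.22) (pp. 335–337)] -/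
theorem integral_mul_finTorusTwistedWeight_one_eq_exp_mul (hρu : ∀ g, ρ g ∈ Matrix.unitaryGroup (Fin n) ℂ) (β : ℝ)
    (Φ : (FinTorusSite L L L T × Fin 4 → G) → ℝ) :
    ∫ V, Φ V * finTorusTwistedWeight ρ β 1 V ∂(Measure.pi fun _ : FinTorusSite L L L T × Fin 4 => haarProbability G) =
      Real.exp (-((T : ℝ) * sliceKernelConst n β L)) *
        ∫ U, Φ (finTorusConfigEquiv G L T U) * FiniteTemperature.weight ρ β β U ∂(FiniteTemperature.haar 3 T L G) := by
  rw [← (measurePreserving_finTorusConfigEquiv (G := G) (L := L) (T := T)).integral_comp', ← integral_const_mul]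
  refine integral_congr_ae (Eventually.of_forall fun U => ?_)
  dsimp only
  rw [finTorusTwistedWeight_one, coe_finTorusConfigEquiv, neg_mul_sum_finTorusPlaquette_comp ρ hρu β U, Real.exp_add,
    FiniteTemperature.weight]
  ring

/-- **Expectations agree**: `⟨Φ⟩^{Fin-box}_{ρ,β}(L,L,L,T) = ⟨Φ ∘ finTorusConfigEquiv⟩^{FT}_{ρ;β,β}` for every observable `Φ`
(unitary `ρ`; the constant `e^{−T c_{β,L}}` cancels). [cite: BorgsSeiler1983, §II.3 (II.22) (p. 337)] [cite: MontvayMunster1994, §3.2.6 (3.145)] -/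
theorem finTorusExpectation_eq_expectation (hρu : ∀ g, ρ g ∈ Matrix.unitaryGroup (Fin n) ℂ) (β : ℝ)
    (Φ : (FinTorusSite L L L T × Fin 4 → G) → ℝ) :
    finTorusExpectation ρ β Φ =
      FiniteTemperature.expectation ρ β β fun U : FiniteTemperature.Config 3 T L G => Φ (finTorusConfigEquiv G L T U) := by
  rw [finTorusExpectation_eq_div, integral_mul_finTorusTwistedWeight_one_eq_exp_mul ρ hρu β Φ,
    wilsonFinTorusPartition_eq_exp_mul_integral_weight hρu β L T, FiniteTemperature.expectation,
    mul_div_mul_left _ _ (Real.exp_pos _).ne']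

/-- **Conversely**: every finite-temperature expectation is a `Fin`-box expectation,
`⟨F⟩^{FT}_{ρ;β,β} = ⟨F ∘ finTorusConfigEquiv⁻¹⟩^{Fin-box}_{ρ,β}(L,L,L,T)`. [cite: BorgsSeiler1983, §II.3 (II.22) (p. 337)] -/
theorem expectation_eq_finTorusExpectation (hρu : ∀ g, ρ g ∈ Matrix.unitaryGroup (Fin n) ℂ) (β : ℝ)
    (F : FiniteTemperature.Config 3 T L G → ℝ) :
    FiniteTemperature.expectation ρ β β F =
      finTorusExpectation ρ β fun V : FinTorusSite L L L T × Fin 4 → G => F ((finTorusConfigEquiv G L T).symm V) := by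
  rw [finTorusExpectation_eq_expectation ρ hρu β]
  simp only [MeasurableEquiv.symm_apply_apply]

/-- **Borgs–Seiler's Polyakov two-point function as a `Fin`-box expectation of time lines**:
`G_L(x) = ⟨Re(tr ρ(P_{(0,0,0)}) · conj tr ρ(P_y))⟩^{Fin-box}_{ρ,β}(L,L,L,T)`, `y` = the `Fin`-coordinates of `x`,
`P = finTorusTimeLine`. [cite: BorgsSeiler1983, §II.3 (II.22) and Lemma II.4 (pp. 336–337)] -/
theorem polyakovCorrelation_eq_finTorusExpectation (hρu : ∀ g, ρ g ∈ Matrix.unitaryGroup (Fin n) ℂ) (β : ℝ)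
    (x : Fin 3 → ZMod L) :
    FiniteTemperature.polyakovCorrelation (L₀ := T) ρ β β x =
      finTorusExpectation ρ β fun V : FinTorusSite L L L T × Fin 4 → G =>
        ((ρ (finTorusTimeLine V ((0 : Fin L), (0 : Fin L), (0 : Fin L)))).trace *
          conj (ρ (finTorusTimeLine V
            ((ZMod.finEquiv L).symm (x 0), (ZMod.finEquiv L).symm (x 1), (ZMod.finEquiv L).symm (x 2)))).trace).re := by
  rw [FiniteTemperature.polyakovCorrelation, expectation_eq_finTorusExpectation ρ hρu β]
  congr 1
  funext V
  simp only [FiniteTemperature.polyakovTrace, polyakovLine_eq_finTorusTimeLine, MeasurableEquiv.apply_symm_apply,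
    Pi.zero_apply, map_zero]

end Expectation

/-! ### Composition with the `0 ↔ 3` axis exchange: Polyakov correlations as expectations of slice observables -/

section Swap

variable {G : Type*} [Group G] {n : ℕ} (ρ : G →* Matrix (Fin n) (Fin n) ℂ) [TopologicalSpace G]
  [IsTopologicalGroup G] [CompactSpace G] [MeasurableSpace G] [BorelSpace G]

omit [TopologicalSpace G] [IsTopologicalGroup G] [CompactSpace G] [MeasurableSpace G] [BorelSpace G] in
/-- No twist: the oriented cocycle of `z = 1` is `1`. [cite: tHooft1979Flux, §2 (2.6)] -/
theorem tHooftTwistCocycle_one {n₀ n₁ n₂ n₃ : ℕ} (x : FinTorusSite n₀ n₁ n₂ n₃) (μ ν : Fin 4) :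
    tHooftTwistCocycle (1 : Fin 4 → G) x μ ν = 1 := by
  simp [tHooftTwistCocycle, tHooftTwistFactor]

/-- **Covariant axis relabelling of twisted integrals with an observable** (named-weight form of
`integral_mul_twistedWeight_relabel`): `∫ Φ(U) w_z(U) dU = ∫ Φ(U' ∘ (e × σ)) w_{z'}(U') dU'`.
[cite: tHooft1979Flux, §2 (2.6) and §6 (6.1)–(6.2)] [cite: MontvayMunster1994, §3.2.6 (3.145)] -/
theorem integral_mul_finTorusTwistedWeight_relabel (hρ : Continuous ρ) (β : ℝ) {a b c d a' b' c' d' : ℕ}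
    (e : FinTorusSite a b c d ≃ FinTorusSite a' b' c' d') (σ : Equiv.Perm (Fin 4))
    (he : ∀ x μ, e (x.shift μ) = (e x).shift (σ μ)) {z z' : Fin 4 → G}
    (hcov : ∀ x μ ν, tHooftTwistCocycle z' (e x) (σ μ) (σ ν) = tHooftTwistCocycle z x μ ν)
    (Φ : (FinTorusSite a b c d × Fin 4 → G) → ℝ) :
    ∫ U, Φ U * finTorusTwistedWeight ρ β z U ∂(Measure.pi fun _ : FinTorusSite a b c d × Fin 4 => haarProbability G) =
      ∫ U', Φ (fun l : FinTorusSite a b c d × Fin 4 => U' (e l.1, σ l.2)) * finTorusTwistedWeight ρ β z' U'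
        ∂(Measure.pi fun _ : FinTorusSite a' b' c' d' × Fin 4 => haarProbability G) :=
  integral_mul_twistedWeight_relabel ρ hρ β e σ he hcov Φ

/-- **The `0 ↔ 3` exchange for untwisted integrals with an observable**: `∫ Φ(V) e^{−βS(V)} dV` over the box
`(a, b, c', d)` equals `∫ Φ(V' ∘ swap₀₃) e^{−βS(V')} dV'` over the box `(d, b, c', a)`,
`(V' ∘ swap₀₃)((x₀,x₁,x₂,x₃), μ) = V'((x₃,x₁,x₂,x₀), (0 3)·μ)`. [cite: MontvayMunster1994, §3.2.6 (3.145)] [cite: tHooft1979Flux, §6 (6.1)–(6.2)] -/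
theorem integral_mul_finTorusTwistedWeight_one_swap03 (hρ : Continuous ρ) (β : ℝ) (a b c d : ℕ)
    (Φ : (FinTorusSite a b c d × Fin 4 → G) → ℝ) :
    ∫ V, Φ V * finTorusTwistedWeight ρ β 1 V ∂(Measure.pi fun _ : FinTorusSite a b c d × Fin 4 => haarProbability G) =
      ∫ V', Φ (fun l : FinTorusSite a b c d × Fin 4 =>
          V' ((l.1.2.2.2, l.1.2.1, l.1.2.2.1, l.1.1), Equiv.swap (0 : Fin 4) 3 l.2)) * finTorusTwistedWeight ρ β 1 V'
        ∂(Measure.pi fun _ : FinTorusSite d b c a × Fin 4 => haarProbability G) :=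
  integral_mul_finTorusTwistedWeight_relabel ρ hρ β
    (⟨fun x => (x.2.2.2, x.2.1, x.2.2.1, x.1), fun y => (y.2.2.2, y.2.1, y.2.2.1, y.1), fun _ => rfl, fun _ => rfl⟩ :
      FinTorusSite a b c d ≃ FinTorusSite d b c a)
    (Equiv.swap 0 3) (fun x μ => by fin_cases μ <;> rfl)
    (fun x μ ν => by rw [tHooftTwistCocycle_one, tHooftTwistCocycle_one]) Φ

/-- **Expectations are invariant under the `0 ↔ 3` exchange**: `⟨Φ⟩(a,b,c',d) = ⟨Φ ∘ swap₀₃⟩(d,b,c',a)` (continuous `ρ`).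
[cite: MontvayMunster1994, §3.2.6 (3.145)] [cite: tHooft1979Flux, §6 (6.1)–(6.2)] -/
theorem finTorusExpectation_swap03 [SecondCountableTopology G] (hρ : Continuous ρ) (β : ℝ) {a b c d : ℕ}
    (Φ : (FinTorusSite a b c d × Fin 4 → G) → ℝ) :
    finTorusExpectation ρ β Φ =
      finTorusExpectation ρ β fun V' : FinTorusSite d b c a × Fin 4 → G =>
        Φ fun l : FinTorusSite a b c d × Fin 4 => V' ((l.1.2.2.2, l.1.2.1, l.1.2.2.1, l.1.1), Equiv.swap (0 : Fin 4) 3 l.2) := by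
  rw [finTorusExpectation_eq_div, finTorusExpectation_eq_div, integral_mul_finTorusTwistedWeight_one_swap03 ρ hρ β,
    wilsonFinTorusPartition_swap03 ρ hρ β a b c d]

variable {L T : ℕ} [NeZero L] [NeZero T]

/-- **Borgs–Seiler's Polyakov two-point function as an expectation of SLICE observables of the second transfer-matrix
reading.**  For continuous unitary `ρ` and `x ∈ (ℤ/L)³` with `Fin`-coordinates `(y₀, y₁, y₂)`:
`G_L(x) = ⟨Re(tr ρ(P_{(0,0)}(𝒰₀)) · conj tr ρ(P_{(y₁,y₂)}(𝒰_{y₀})))⟩_{ρ,β}` in the box `T × L × L × L` sliced along its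
last axis (period `L`; slices = link configurations of the spatial box `T × L × L`, whose FIRST axis is the
temperature circle), `P_q(a) = finSlicePolyakovHolonomy a q`, `𝒰_t = finTorusSlice V' t` — the Polyakov correlation at
separation `x` is a correlation between multiplication operators on the slices `0` and `y₀` of the transfer matrix in
a spatial direction (Borgs–Seiler §III.2: "transfer matrix in the spatial 1-direction"), ready for the two-insertion
slicing `integral_sliceObs_two_mul_finTorusWeight` (`Z·⟨F₁(𝒰₀)F₂(𝒰_p)⟩ = ∫ F₁(V 0) F₂(V p) ∏ₜ K_β(V t, V (t+1)) dV`).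
[cite: BorgsSeiler1983, §II.3 (II.22) (p. 337) and §III.2 (p. 349)] [cite: MontvayMunster1994, §1.5.2 (1.195)] -/
theorem polyakovCorrelation_eq_finTorusExpectation_swap03 [SecondCountableTopology G] (hρ : Continuous ρ)
    (hρu : ∀ g, ρ g ∈ Matrix.unitaryGroup (Fin n) ℂ) (β : ℝ) (x : Fin 3 → ZMod L) :
    FiniteTemperature.polyakovCorrelation (L₀ := T) ρ β β x =
      finTorusExpectation ρ β fun V' : FinTorusSite T L L L × Fin 4 → G =>
        ((ρ (finSlicePolyakovHolonomy (finTorusSlice V' 0) ((0 : Fin L), (0 : Fin L)))).trace *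
          conj (ρ (finSlicePolyakovHolonomy (finTorusSlice V' ((ZMod.finEquiv L).symm (x 0)))
            ((ZMod.finEquiv L).symm (x 1), (ZMod.finEquiv L).symm (x 2)))).trace).re := by
  rw [polyakovCorrelation_eq_finTorusExpectation ρ hρu β x, finTorusExpectation_swap03 ρ hρ β]
  simp only [finTorusTimeLine_swap03]

end Swap

/-! ### General pairs: translation invariance, and the summands of the slice-magnetisation correlations -/

section Pairs

variable {G : Type*} [Group G] {n : ℕ} (ρ : G →* Matrix (Fin n) (Fin n) ℂ) [TopologicalSpace G]
  [IsTopologicalGroup G] [CompactSpace G] [MeasurableSpace G] [BorelSpace G] [SecondCountableTopology G]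

/-- **Pair correlations by translation invariance**: for all spatial sites `x, y` of the periodic box,
`⟨Re(χ(g_{L_x}) χ̄(g_{L_y}))⟩_{J_E,J_M} = G_L(y − x)` (`= Re K(x, y) = Re K(0, y − x)`, `FiniteTemperature.polyakovKernel_add`:
"we assumed translation invariance, as guaranteed for instance by periodic b.c.").
[cite: BorgsSeiler1983, §II.3 (II.22) (p. 337)] -/
theorem expectation_re_polyakovTrace_mul_conj {d L₀ L : ℕ} [NeZero L₀] [NeZero L] (hρ : Continuous ρ) (JE JM : ℝ)
    (x y : Fin d → ZMod L) :
    FiniteTemperature.expectation (L₀ := L₀) ρ JE JM (fun U : FiniteTemperature.Config d L₀ L G =>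
        (FiniteTemperature.polyakovTrace ρ U x * conj (FiniteTemperature.polyakovTrace ρ U y)).re) =
      FiniteTemperature.polyakovCorrelation (L₀ := L₀) ρ JE JM (y - x) := by
  -- the expectation is the real part of the complex kernel `K(x, y)`
  have h1 : FiniteTemperature.expectation (L₀ := L₀) ρ JE JM (fun U : FiniteTemperature.Config d L₀ L G =>
      (FiniteTemperature.polyakovTrace ρ U x * conj (FiniteTemperature.polyakovTrace ρ U y)).re) =
        (FiniteTemperature.polyakovKernel (L₀ := L₀) ρ JE JM x y).re := by
    unfold FiniteTemperature.expectation FiniteTemperature.polyakovKernel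
    rw [Complex.div_ofReal_re]
    congr 1
    have h := integral_re (FiniteTemperature.integrable_polyakovKernel_integrand (L₀ := L₀) ρ hρ JE JM x y)
    simp only [RCLike.re_to_complex] at h
    rw [← h]
    refine integral_congr_ae (Eventually.of_forall fun U => ?_)
    simp only [Complex.mul_re, Complex.ofReal_re, Complex.ofReal_im, mul_zero, sub_zero]
  -- translation invariance: `K(x, y) = K(0 + x, (y - x) + x) = K(0, y - x)`
  have h2 : FiniteTemperature.polyakovKernel (L₀ := L₀) ρ JE JM x y =
      FiniteTemperature.polyakovKernel (L₀ := L₀) ρ JE JM 0 (y - x) := by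
    rw [← FiniteTemperature.polyakovKernel_add ρ JE JM 0 (y - x) x, zero_add, sub_add_cancel]
  rw [h1, h2, ← FiniteTemperature.polyakovCorrelation_eq_re_polyakovKernel ρ hρ]

variable {L T : ℕ} [NeZero L] [NeZero T]

/-- **The summands of the slice-magnetisation correlations are Polyakov correlations.**  In the box `T × L × L × L`
(sliced along its last axis; slices = configurations of the spatial box `T × L × L` whose first axis is the
temperature circle), for ANY slice indices `s, s' : Fin L` and transverse positions `q, q' : Fin L × Fin L`,
`⟨Re(tr ρ(P_q(𝒰_s)) · conj tr ρ(P_{q'}(𝒰_{s'})))⟩_{ρ,β} = G_L((s', q') − (s, q))` (continuous unitary `ρ`; the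
difference taken in `(ℤ/L)³` along `ZMod.finEquiv`) — so that `⟨m(𝒰_s) m(𝒰_{s'})⟩ = Σ_{q,q'} G_L((s'−s, q'−q))` for real
traces (`finTorusExpectation_finset_sum`).  Borgs–Seiler's transfer matrix in a spatial direction, §III.2.
[cite: BorgsSeiler1983, §II.3 (II.22) (p. 337) and §III.2 (p. 349)] [cite: MontvayMunster1994, §1.5.2 (1.195)] -/
theorem finTorusExpectation_slicePolyakov_pair_swap03 (hρ : Continuous ρ)
    (hρu : ∀ g, ρ g ∈ Matrix.unitaryGroup (Fin n) ℂ) (β : ℝ) (y y' : FinSpatialSite L L L) :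
    finTorusExpectation ρ β (fun V' : FinTorusSite T L L L × Fin 4 → G =>
        ((ρ (finSlicePolyakovHolonomy (finTorusSlice V' y.1) (y.2.1, y.2.2))).trace *
          conj (ρ (finSlicePolyakovHolonomy (finTorusSlice V' y'.1) (y'.2.1, y'.2.2))).trace).re) =
      FiniteTemperature.polyakovCorrelation (L₀ := T) ρ β β
        (![ZMod.finEquiv L y'.1, ZMod.finEquiv L y'.2.1, ZMod.finEquiv L y'.2.2] -
          ![ZMod.finEquiv L y.1, ZMod.finEquiv L y.2.1, ZMod.finEquiv L y.2.2]) := by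
  rw [← expectation_re_polyakovTrace_mul_conj ρ hρ β β, expectation_eq_finTorusExpectation ρ hρu β,
    finTorusExpectation_swap03 ρ hρ β]
  -- (`rw` has moved the exchange onto the left-hand side: both are now expectations in the box `L × L × L × T`)
  congr 1
  funext V'
  simp only [FiniteTemperature.polyakovTrace, ← finTorusTimeLine_finTorusConfigEquiv, MeasurableEquiv.apply_symm_apply,
    finSlicePolyakovHolonomy_finTorusSlice_swap03]

end Pairs

end Literature.MathematicalPhysics.QuantumFieldTheory
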